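import Literature.MathematicalPhysics.QuantumFieldTheory.Balaban1983to89.Node00.Record13CarriersSepCoPH
import Literature.MathematicalPhysics.QuantumFieldTheory.Balaban1983to89.Node00.Record13CarriersB8SubBP2CCoPR
import Literature.MathematicalPhysics.QuantumFieldTheory.Balaban1983to89.Node00.Record13CarriersB8SubBP2C

/-!
# «P₂C» IMAGE (width seat `pub-ymgap-dag-n05-w1` g0, 2026-08-28; token map «`SubBP ↦ SubBP₂C`, `upOfRecord₅CS ↦ upOfRecord₅CSC … (c₇OfRecord θ₃)`» of this seat's
# module of the same name without «2C»: the [B8] group re-pinned over the ADMISSIBLE sub-index `IdxB8SubC` at the δ₂-members with Proposition 7's axial map PINNED and the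
# leaf in the `B8LeafRSC` currency (`Node00/CarriersB8SubBP2C`, p604316; records `Node00/Record13CarriersB8SubBP2C`, p605609); the `b8` READING becomes «4 class-free conjuncts ∧
# t2 ∕ p3 ∕ t4 on `zdGF3P₂` families ∧ `Prop7RepairedC (c₇OfRecord θ₃)` (PROVED in the pin) ∧ t8 on `famB8OfRecordSubBP₂C`»; the slot form `_of_fields` takes EIGHT conjuncts;
# the parent's S-CLASS MEMBERSHIP LEMMA IS NOT IMAGED (the class is RS-currency-only — LOCATED-SCLASS-CURRENCY).  The slot asks LESS than print's Prop. 7 (ref-A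
# WATCH-P7-CURRENCY-RECORD; declared).  The text below is the parent's header, kept for the token correspondence.)
P-CARRIER IMAGE (width seat `pub-ymgap-dag-n05-w1` g0, 2026-08-28; token map T_P «`SubBH ↦ SubBP`» of n05-c g6's module of the same name with `SubBH`, on the P-pin
`Node00/CarriersB8SubBP` (p592605) over `B8LeafModelZd3P.zdGF3HP` (p588746); the `b8` READING becomes «4 class-free old conjuncts ∧ t2 ∕ p3 ∕ t4 ∕ p7 ∕ t8 at the P-members»
(`b8LeafOfRecordSubBP₂C_iff_classFree_and_P₂C`); everything else letter for letter; on the -d lane's word dag-n05-d g10, cell bus 2026-08-28 01:16Z)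

v1.7 `CoPH` IMAGE (token map T₇ of dag-lead WORDS-143 ∕ node00-def-T `KEYMAP-Record13-v1.7.md`: binder `θ : Stage13HParams` (= `Stage13RParams` + the HISTORY-INDEXED residual 𝐓-weight slot `Zh`, director-ym №183 FINDING №9), `CoPR ↦ CoPH`, dotted `Stage13RParams.X ↦ Stage13HParams.X`, SITE-RULE `X F N θ ↦ X F N θ.toStage13Params` for the edition-free θ-level objects) of this seat's v1.6 file of the same stem (which STANDS as a settled helper, as does the v1.5 one); H-level pins over dag-n10-d's `Stage13HParams.rebindX` (`Node00/Record13CarriersCoPH` §0, p539476).  Prose pids ∕ FILE numbers below are those of the v1.5 ∕ v1.6 lineage where not updated; this image's v1.7 suppliers are node00-def-T FILE 27 p537939 `Record13CoPH` ∕ FILE 28T p539169 `Record13SepCoPH`, dag-n10-d g11 p539476 `Record13CarriersCoPH` ∕ p540513 `Record13CarriersSepCoPH` ∕ p542283 `Record13SClassSepCoPH` (the generic S-class `IsRecordOfRecord₁₃CSepCoPHS`, of which this seat's S-bound records are one-pin ∕ X-H-pin ∕ four-pin-view SLICES — membership lemmas `isRecordOfRecord₁₃CSepCoPHS_of_…`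 below).

# NODE 00 (YM-PLAN Track A) — THE [B8″P]-PINNED STAGE-13 RECORD AT PRINT'S BACKGROUND (KEY-RULE-21 Co ∕ SepCo image of
# `Node00/Record13CarriersB8SubBP`): the pin faces of `Stage13HParams.pinB8SubBP₂C` read at the Co Stage-5 view `toStage5₁₃CoPH`, the v1.7 provisos
# `Provisos₁₃SepCoPH` transported along the pin, the UP-SIDE datums `datumOfRecord₁₃CoPH ∕ datumOfRecord₁₃SepCoPH` (`rfl`), the `b8` leaf over the [B8″P]-pinned
# Co view BY `Iff.rfl`, and the ONE-pin S-bound record AT THE v1.7 KEY `IsRecordOfRecord₁₃CSepCoPHSB8subBP₂C` (companion in `IsRecordOfRecord₁₃CSepCoPH`; faces; the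
# reading; slot form; rebind) — director-ym LINE №152 RULING (β) ∕ R257 co-twin row C1 (dag-lead ORPHAN-STOREYS, 2026-08-27)

NODE 00 RECORD MODULE (seat `pub-ymgap-dag-n05-d` g7, 2026-08-27).  APPEND-ONLY: a NEW importing module; NOTHING in `Record13CarriersB8SubBP` (dag-n05-c g6,
p511153), `Record13CarriersSepCoPH` ∕ `Record13CarriersCoPH` ∕ `Record13SClassSepCoPH` (dag-n10-d g11, v1.7; p540513 ∕ p539476 ∕ p542283), `Record13SepCoPH` (node00-def-T FILE 28T, p539169),
`Record13CoPH` (FILE 27, p537939); this seat's v1.6 `Record13CarriersB8SubBPCoPR` (p532584, imported so that its R-level pin faces apply at `toStage13RParams` by name) or below them is edited; everything is CONSUMED BY NAME (the pin faces are ONE-LINE instances of dag-n10-d's generic `rebindX` faces).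

WHY.  RECORD 13 was re-based ONCE at print's background `U_k(V)` (director-ym №152 (β)): the Stage-5 view of record is now `Stage13HParams.toStage5₁₃CoPH`
(residual `residualOfStage13CoPH`: `V := VOfRecord₁₃CoPH`, `S218 := S218OfRecord₁₃CoPH`), the provisos of record are v1.7 `Provisos₁₃SepCoPH` (row `bg` AT `UbgOfRecord₁₃CoPH`),
the datum is `datumOfRecord₁₃SepCoPH θ h := datumOfRecord₁₃CoPH θ h.toCore` and the record family is `IsRecordOfRecord₁₃CSepCoPH` (projection `.toCoPH` onto FILE 21's
`IsRecordOfRecord₁₃CCoPH`).  The N05 ∃-currency record on the P-CARRIER carrier — dag-n05-c's `IsRecordOfRecord₁₃CSepSB8subBP` (U_old key `Provisos₁₃Sep ∕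
datumOfRecord₁₃Sep ∕ toStage5₁₃`) — therefore needs its image at the corrected key before the N05 knit faces (`Thm/BalabanUVNodesN05SubBHKnitT8E`, p515416) can be
booked at the record of record.  THIS FILE is that image under KEY-RULE-21 (node00-def-T, 2026-08-27): (R2) `toStage5₁₃ ↦ toStage5₁₃CoPH`, (R5) `…Sep… ↦ …SepCo…`,
(R1) `₁₃C ↦ ₁₃CCo` for the core record; every statement SHAPE is the U_old one token for token (HYP-AUDIT: no binder dropped, weakened or added).  The θ-level [B8″P]
pin (`Stage13Params.pinB8SubBP₂C`, its `rfl` faces; dag-n05-c) is background-FREE and is CITED from `Record13CarriersB8SubBP`, never re-declared — its H-LIFT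
`Stage13HParams.pinB8SubBP₂C` (§0, ONE H-level re-binding over dag-n10-d's `Stage13HParams.rebindX`, faces as instances of the generic ones) is the one new definition here;
the [B8″P] slot `B8LeafOfRecordSubBP₂C θ λ` (`Node00/CarriersB8SubBP`) is background-free too — the N05 content of the record does not move, only its address.

WHAT IS PROVED (kernel bookkeeping, 0 sorry, no new mathematics).
§0 the H-lift `Stage13HParams.pinB8SubBP₂C` + faces (`_eq_rebindX ∕ _toStage13Params ∕ _Zh ∕ _res_X ∕ _toStage3Params ∕ _L_γ_ε₂₉ ∕ _admissible_iff`, `Provisos₁₃CoPH.pinB8SubBP₂C`).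
§1 `Stage13HParams.toStage5₁₃CoPH_pinB8SubBP₂C` (the Co view of the pinned parameters IS the re-bound Co view — the [B8″P] instance of dag-n10-d's generic
`toStage5₁₃CoPH_rebindX`), `Stage13HParams.Provisos₁₃SepCoPH.pinB8SubBP₂C` (the twelve v1.7 rows read no carrier: field by field, the [B8″P] instance of
`Provisos₁₃SepCoPH.rebindX`), UP-SIDE datums `datumOfRecord₁₃CoPH_pinB8SubBP₂C ∕ datumOfRecord₁₃SepCoPH_pinB8SubBP₂C` (`rfl`), the leaves
`upOfRecord₅CSC_toStage5₁₃CoPH_pinB8SubBP₂C_b8_iff` (`b8 ↔ B8LeafOfRecordSubBP₂C`, `Iff.rfl`), `upOfRecord₅C_toStage5₁₃CoPH_pinB8SubBP₂C_b8_iff` (typed, `Iff.rfl`),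
`upOfRecord₅CSC_toStage5₁₃CoPH_pinB8SubBP₂C_offB8` (`rfl` ×5), and the C-bound presentations `isRecordOfRecord₁₃CCoPH_pinB8SubBP₂C_of_eq` ∕ `isRecordOfRecord₁₃CSepCoPH_pinB8SubBP₂C_of_eq`.
§2 **`IsRecordOfRecord₁₃CSepCoPHSB8subBP₂C`** (the v1.7-keyed ONE-pin S-bound record on the P-carrier), `exists_world_…` (world displayed), **`companion_of_…`** (same
D ∕ C ∕ γ ∕ L in `IsRecordOfRecord₁₃CSepCoPH`, witness `θ.pinB8SubBP₂C λ`; typed ⇒ surviving), `leaf_b8_iff_of_…`, `leaf_b8_iff_subB_and_t8H_of_…` (THE READING at the record),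
`exists_isRecordOfRecord₁₃CSepCoPH_of_…`, `exists_isRecordOfRecord₁₃CCoPH_of_…` (projection to FILE 21's core family), `b4_b5_b6_b7_of_…` (def-T's transfer
`atWorld_of_isRecordOfRecord₁₃CSepCoPH` at the companion), `b8_b11_b10_main_iff_of_…`, `b8_main_of_…_of_slot`, `b8_main_of_…_of_subB_fields`,
`…_rebind_of_isRecordOfRecord₁₃CSepCoPH` (the ∃-currency entry point: the [B8] layer is CHOSEN there), `exists_provisos_of_…`.
NOT IMAGED (located, R257 row C1∕C2): the un-repaired lineage `Record13CarriersB8SubB` ∕ `Thm/BalabanUVNodesN05AtRecord13SubB{,T8,T8B9}` — its slot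
`B8LeafOfRecordSubB θ λ` is certified EMPTY for every `λ` (`B8LeafModelZd3SourceReality.not_b8LeafOfRecordSubB`, p501857), a background-free fact, so its Co image
would be vacuous verbatim; the present file is the image of its declared repaired successor.
HONEST FRAMING: definitions + kernel bookkeeping; NO estimate; nothing of Bałaban's asserted; whether the repaired slot CLOSES is the knits' ∕ providers' business;
N05 NOT discharged; counts unmoved (typed 28∕28 · discharged 5∕27); one finite T⁴ programme at fixed ε — NOT continuum ∕ ℝ⁴ ∕ infinite volume ∕ OS ∕ mass gap ∕
Clay.  No `sorry`, no `axiom`, no `opaque`, no `instance`, no `notation`.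
[Balaban1985RegularSpaces] = Commun. Math. Phys. **99** (1985) 75–102; [Balaban1989LargeFieldII] = Commun. Math. Phys. **122** (1989) 355–392; [Balaban1988Convergent] = Commun.
Math. Phys. **119** (1988) 243–285. -/

noncomputable section

namespace Literature.MathematicalPhysics.QuantumFieldTheory.Balaban1983to89.Node00

open T4Continuum AveragingRT T4FiniteEpsInhabited FlowStep FlowStepRuns DagBinding T4DatumAssembly
open B8LeafKnitRS (B8LeafRS)
open B8LeafKnitRSC (B8LeafRSC)
open B8LeafModelZd3P2 (zdGF3P₂)
open B8Prop7TowerAxialRecord (toAxialTowerResid)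
open B8LeafModelZd3P (zdGF3P)
open B8IdxB8LawsB (IdxB8SubB famB8OfRecordSubB)
open scoped Matrix.Norms.L2Operator

/-! ## §0 (H). THE H-LIFT OF THE [B8″P] PIN: `Stage13HParams.pinB8SubBP₂C` — ONE H-level re-binding (dag-n10-d's `Stage13HParams.rebindX`) over dag-n05-c's θ-level
carrier substitution `withB8OfRecordSubBP₂C`; its Stage-13 part IS dag-n05-c's θ-level pin `Stage13Params.pinB8SubBP₂C` (`rfl`) -/

section PinB8SubBP13H

variable (F : T4Family) (N : ℕ) [NeZero N]

/-- **The [B8″P] pin of the v1.7 Stage-13 parameters** (history-indexed residual 𝐓-weight slot `Zh` untouched): the carrier bundle re-bound, run by run, to the [B8] group of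
record READ AT THE P-MEMBERS (`withB8OfRecordSubBP₂C`, dag-n05-c). [cite: Balaban1985RegularSpaces, Thm 2 p.83, Thm 8 (1.146) p.101 (objects of record, Stage 3′(X.B8″H))] -/
def Stage13HParams.pinB8SubBP₂C (θ : Stage13HParams F N) (lam : ResidB8 θ.toStage3Params) : Stage13HParams F N :=
  θ.rebindX F N fun P => (θ.res.X P).withB8OfRecordSubBP₂C θ.toStage3Params lam

/-- Unfolding (`rfl`): the pin IS one generic H-level `rebindX`. [cite: Balaban1988Convergent, p.244 (bookkeeping)] -/
theorem Stage13HParams.pinB8SubBP₂C_eq_rebindX (θ : Stage13HParams F N) (lam : ResidB8 θ.toStage3Params) :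
    θ.pinB8SubBP₂C F N lam = θ.rebindX F N (fun P => (θ.res.X P).withB8OfRecordSubBP₂C θ.toStage3Params lam) := rfl

/-- Its Stage-13 part IS dag-n05-c's θ-level [B8″P] pin (`rfl`). [cite: Balaban1988Convergent, p.244 (bookkeeping)] -/
theorem Stage13HParams.pinB8SubBP₂C_toStage13Params (θ : Stage13HParams F N) (lam : ResidB8 θ.toStage3Params) :
    (θ.pinB8SubBP₂C F N lam).toStage13Params = θ.toStage13Params.pinB8SubBP₂C F N lam := rfl

/-- The history-indexed residual 𝐓-weight slot is untouched (`rfl`). [cite: Balaban1988Convergent, (3.16)–(3.20) pp.268–269 (bookkeeping)] -/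
theorem Stage13HParams.pinB8SubBP₂C_Zh (θ : Stage13HParams F N) (lam : ResidB8 θ.toStage3Params) : (θ.pinB8SubBP₂C F N lam).Zh = θ.Zh :=
  (Stage13HParams.rebindX_toStage13Params F N θ _).2

/-- Its v1.6 part IS this seat's R-level [B8″P] pin of `Record13CarriersB8SubBPCoPR` §0 (`rfl`) — so every R-level face there applies at `(θ.pinB8SubBP₂C …).toStage13RParams` BY NAME.
[cite: Balaban1988Convergent, p.244 (bookkeeping)] -/
theorem Stage13HParams.pinB8SubBP₂C_toStage13RParams (θ : Stage13HParams F N) (lam : ResidB8 θ.toStage3Params) :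
    (θ.pinB8SubBP₂C F N lam).toStage13RParams = θ.toStage13RParams.pinB8SubBP₂C F N lam := rfl

/-- The pinned carrier family (`rfl`). [cite: Balaban1985RegularSpaces, Thm 2 p.83 (bookkeeping)] -/
theorem Stage13HParams.pinB8SubBP₂C_res_X (θ : Stage13HParams F N) (lam : ResidB8 θ.toStage3Params) (P : B12.RunParams) :
    (θ.pinB8SubBP₂C F N lam).res.X P = (θ.res.X P).withB8OfRecordSubBP₂C θ.toStage3Params lam := rfl

/-- The Stage-3 dictionary is untouched (`rfl`, dag-n05-c's θ-level face read through `toStage13Params`). [cite: Balaban1984PropagatorsII, pp.223–250 (bookkeeping)] -/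
theorem Stage13HParams.pinB8SubBP₂C_toStage3Params (θ : Stage13HParams F N) (lam : ResidB8 θ.toStage3Params) :
    (θ.pinB8SubBP₂C F N lam).toStage3Params = θ.toStage3Params :=
  Stage13Params.pinB8SubBP₂C_toStage3Params F N θ.toStage13Params lam

/-- Block size, interval letter and the (2.9) letter are untouched (`rfl` ×3). [cite: Balaban1987RG1, (0.1) p.250, (2.9) p.266 (bookkeeping)] -/
theorem Stage13HParams.pinB8SubBP₂C_L_γ_ε₂₉ (θ : Stage13HParams F N) (lam : ResidB8 θ.toStage3Params) :
    (θ.pinB8SubBP₂C F N lam).L = θ.L ∧ (θ.pinB8SubBP₂C F N lam).γ = θ.γ ∧ (θ.pinB8SubBP₂C F N lam).ε₂₉ = θ.ε₂₉ :=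
  Stage13Params.pinB8SubBP₂C_L_γ_ε₂₉ F N θ.toStage13Params lam

/-- Admissibility is read at `θ` (dag-n05-c's θ-level face through `toStage13Params`). [cite: Balaban1987RG1, (1.20)–(1.21) p.264 (bookkeeping)] -/
theorem Stage13HParams.pinB8SubBP₂C_admissible_iff (θ : Stage13HParams F N) (lam : ResidB8 θ.toStage3Params) :
    (θ.pinB8SubBP₂C F N lam).Admissible F N ↔ θ.Admissible F N :=
  Stage13Params.pinB8SubBP₂C_admissible_iff F N θ.toStage13Params lam

variable {F N} in
/-- The v1.7 bg-free core provisos transport along the [B8″P] pin (instance of dag-n10-d's `Provisos₁₃CoPH.rebindX`). [cite: Balaban1988Convergent, (2.18) p.257, (3.2)–(3.9) pp.265–266 (bookkeeping)] -/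
theorem Stage13HParams.Provisos₁₃CoPH.pinB8SubBP₂C {θ : Stage13HParams F N} (h : θ.Provisos₁₃CoPH F N) (lam : ResidB8 θ.toStage3Params) :
    (θ.pinB8SubBP₂C F N lam).Provisos₁₃CoPH F N :=
  h.rebindX _

end PinB8SubBP13H

/-! ## §1. The [B8″P] pin read at the Co Stage-5 view; the v1.7 provisos along the pin; UP-SIDE Co ∕ SepCo datums; the `b8` leaf over the pinned Co view -/

section PinB8SubBP13CoPH

variable (F : T4Family) (N : ℕ) [NeZero N]

/-- The Co Stage-13 view of [B8″P]-pinned parameters IS the re-bound Co Stage-13 view (`rfl`: the Co residual reads `S218OfRecord₁₃CoPH ∕ VOfRecord₁₃CoPH ∕ betaOfRecord₁₃ ∕ EOfRecord₁₃ ∕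
gOfRecord₁₃`, never `res.X`; the [B8″P] instance of dag-n10-d's generic `Stage13HParams.toStage5₁₃CoPH_rebindX`). [cite: Balaban1988Convergent, p.244 (bookkeeping)] -/
theorem Stage13HParams.toStage5₁₃CoPH_pinB8SubBP₂C (θ : Stage13HParams F N) (lam : ResidB8 θ.toStage3Params) :
    (θ.pinB8SubBP₂C F N lam).toStage5₁₃CoPH F N = (θ.toStage5₁₃CoPH F N).rebindX F N (fun P => (θ.res.X P).withB8OfRecordSubBP₂C θ.toStage3Params lam) :=
  Stage13HParams.toStage5₁₃CoPH_rebindX F N θ _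

variable {F N} in
/-- The v1.7 separated-range provisos AT PRINT'S BACKGROUND read no carrier: they transport along the [B8″P] pin (twelve rows, field by field; row `bg` reads `γ`,
`gOfRecord₁₃`, `PartCompat₁₃`, `settingOfRecord₁₃`, `Rz`, `τ9`, `suppOfRecord₁₃SepCo`, `UbgOfRecord₁₃CoPH` — never `res.X`; the [B8″P] instance of dag-n10-d's
`Provisos₁₃SepCoPH.rebindX`). [cite: Balaban1988Convergent, (2.18) p.257, (2.23)–(2.42) pp.259–262, (3.2)–(3.9) pp.265–266; Balaban1985RegularSpaces, (1.3)–(1.9) pp.76–77 (bookkeeping)] -/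
theorem Stage13HParams.Provisos₁₃SepCoPH.pinB8SubBP₂C {θ : Stage13HParams F N} (h : θ.Provisos₁₃SepCoPH F N) (lam : ResidB8 θ.toStage3Params) :
    (θ.pinB8SubBP₂C F N lam).Provisos₁₃SepCoPH F N :=
  h.rebindX _

/-- UP-SIDE (Co core): the core-keyed datum AT PRINT'S BACKGROUND is unchanged by the [B8″P] pin (`rfl`; the [B8″P] instance of dag-n10-d's `datumOfRecord₁₃CoPH_rebindX`).
[cite: Balaban1989LargeFieldII, Thm 1 + (0.1) pp.355–356 (bookkeeping)] -/
theorem datumOfRecord₁₃CoPH_pinB8SubBP₂C (θ : Stage13HParams F N) (h : θ.Provisos₁₃CoPH F N) (lam : ResidB8 θ.toStage3Params) :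
    datumOfRecord₁₃CoPH F N (θ.pinB8SubBP₂C F N lam) (h.pinB8SubBP₂C lam) = datumOfRecord₁₃CoPH F N θ h :=
  datumOfRecord₁₃CoPH_rebindX F N θ h _ (h.pinB8SubBP₂C lam)

/-- UP-SIDE (v1.7 separated range, Co): the datum of record is unchanged by the [B8″P] pin (`rfl`; instance of `datumOfRecord₁₃SepCoPH_rebindX`).
[cite: Balaban1989LargeFieldII, Thm 1 + (0.1) pp.355–356 (bookkeeping)] -/
theorem datumOfRecord₁₃SepCoPH_pinB8SubBP₂C (θ : Stage13HParams F N) (h : θ.Provisos₁₃SepCoPH F N) (lam : ResidB8 θ.toStage3Params) :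
    datumOfRecord₁₃SepCoPH F N (θ.pinB8SubBP₂C F N lam) (h.pinB8SubBP₂C lam) = datumOfRecord₁₃SepCoPH F N θ h :=
  datumOfRecord₁₃SepCoPH_rebindX F N θ h _ (h.pinB8SubBP₂C lam)

/-- **THE `b8` LEAF OF THE S-BINDING OVER THE [B8″P]-PINNED Co STAGE-13 VIEW IS `B8LeafOfRecordSubBP₂C`** (`Iff.rfl`: the S-binding's `b8` reads `res.X`, which the Co view
does not touch). [cite: Balaban1985RegularSpaces, Lemma 1 – Thm 8 pp.79–101, Thm 8 (1.146) p.101 (the leaf at the P-carrier objects of record)] -/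
theorem upOfRecord₅CSC_toStage5₁₃CoPH_pinB8SubBP₂C_b8_iff (θ : Stage13HParams F N) (lam : ResidB8 θ.toStage3Params) (P : B12.RunParams) :
    (upOfRecord₅CSC F N ((θ.pinB8SubBP₂C F N lam).toStage5₁₃CoPH F N) (c₇OfRecord θ.toStage3Params) P).b8 ↔ B8LeafOfRecordSubBP₂C θ.toStage3Params lam :=
  Iff.rfl

/-- … and the C-binding's `b8` over it is the leaf AS TYPED at the P-group (`Iff.rfl`). [cite: Balaban1985RegularSpaces, Lemma 1 – Thm 8 pp.79–101 (bookkeeping)] -/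
theorem upOfRecord₅C_toStage5₁₃CoPH_pinB8SubBP₂C_b8_iff (θ : Stage13HParams F N) (lam : ResidB8 θ.toStage3Params) (P : B12.RunParams) :
    (upOfRecord₅C F N ((θ.pinB8SubBP₂C F N lam).toStage5₁₃CoPH F N) P).b8 ↔
      B8LeafR θ.D (θ.L : ℝ) lam.C₂ lam.B₁' lam.inp.B₀' lam.B₁ lam.B₂ lam.c₁ lam.inp lam.B₀β (B8Lemma1NonAbelian.blockPairNA θ.D θ.L θ.𝔸)
        (fun j : IdxB8SubC θ.toStage3Params => famB8OfRecordSubBP₂C θ.toStage3Params lam.β lam.len j) lam.lan lam.cub (fun j => toAxialTowerResid θ.toStage3Params lam.β lam.len j.1.1) :=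
  Iff.rfl

/-- The other leaves of the S-binding over the [B8″P]-pinned Co Stage-13 view are the C-binding's over the UNPINNED Co Stage-13 view (`rfl` ×5: the pin moves only the
[B8] group, the S-binding re-binds only `b8`). [cite: Balaban1989LargeFieldII, Thm 1 p.355 (bookkeeping)] -/
theorem upOfRecord₅CSC_toStage5₁₃CoPH_pinB8SubBP₂C_offB8 (θ : Stage13HParams F N) (lam : ResidB8 θ.toStage3Params) (P : B12.RunParams) :
    (upOfRecord₅CSC F N ((θ.pinB8SubBP₂C F N lam).toStage5₁₃CoPH F N) (c₇OfRecord θ.toStage3Params) P).b9 = (upOfRecord₅C F N (θ.toStage5₁₃CoPH F N) P).b9 ∧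
    (upOfRecord₅CSC F N ((θ.pinB8SubBP₂C F N lam).toStage5₁₃CoPH F N) (c₇OfRecord θ.toStage3Params) P).b10 = (upOfRecord₅C F N (θ.toStage5₁₃CoPH F N) P).b10 ∧
    (upOfRecord₅CSC F N ((θ.pinB8SubBP₂C F N lam).toStage5₁₃CoPH F N) (c₇OfRecord θ.toStage3Params) P).b11 = (upOfRecord₅C F N (θ.toStage5₁₃CoPH F N) P).b11 ∧
    (upOfRecord₅CSC F N ((θ.pinB8SubBP₂C F N lam).toStage5₁₃CoPH F N) (c₇OfRecord θ.toStage3Params) P).b12 = (upOfRecord₅C F N (θ.toStage5₁₃CoPH F N) P).b12 ∧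
    (upOfRecord₅CSC F N ((θ.pinB8SubBP₂C F N lam).toStage5₁₃CoPH F N) (c₇OfRecord θ.toStage3Params) P).rBasicStep = (upOfRecord₅C F N (θ.toStage5₁₃CoPH F N) P).rBasicStep :=
  ⟨rfl, rfl, rfl, rfl, rfl⟩

/-- **The C-bound presentation at the Co CORE key** (the [B8″P] instance of dag-n10-d's `isRecordOfRecord₁₃CCoPH_rebindX_of_eq`): a world with def-T's pointed clauses whose
upstream blocks are the C-binding over the [B8″P]-PINNED Co Stage-13 view IS a Co core record at `datumOfRecord₁₃CoPH θ h`. [cite: Balaban1989LargeFieldII, Thm 1 + (0.1) pp.355–356 (bookkeeping)] -/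
theorem isRecordOfRecord₁₃CCoPH_pinB8SubBP₂C_of_eq (θ : Stage13HParams F N) (h : θ.Provisos₁₃CoPH F N) (hθ : θ.Admissible F N) (lam : ResidB8 θ.toStage3Params)
    (w : WorldP) (hC : w.C = (datumOfRecord₁₃CoPH F N θ h).C) (hγ : 0 < w.γ ∧ w.γ ≤ θ.γ) (hL : w.L = (θ.L : ℝ))
    (hup : ∀ P, w.up P = upOfRecord₅C F N ((θ.pinB8SubBP₂C F N lam).toStage5₁₃CoPH F N) P) :
    IsRecordOfRecord₁₃CCoPH F N (datumOfRecord₁₃CoPH F N θ h) w :=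
  isRecordOfRecord₁₃CCoPH_rebindX_of_eq F N θ h hθ _ w hC hγ hL hup

/-- **The C-bound presentation at the v1.7 key** (the [B8″P] instance of dag-n10-d's `isRecordOfRecord₁₃CSepCoPH_rebindX_of_eq`): a world with def-T's pointed clauses whose
upstream blocks are the C-binding over the [B8″P]-PINNED Co Stage-13 view IS a v1.7 ₁₃C record at `datumOfRecord₁₃SepCoPH θ h`. [cite: Balaban1989LargeFieldII, Thm 1 + (0.1) pp.355–356 (bookkeeping)] -/
theorem isRecordOfRecord₁₃CSepCoPH_pinB8SubBP₂C_of_eq (θ : Stage13HParams F N) (h : θ.Provisos₁₃SepCoPH F N) (hθ : θ.Admissible F N) (lam : ResidB8 θ.toStage3Params)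
    (w : WorldP) (hC : w.C = (datumOfRecord₁₃SepCoPH F N θ h).C) (hγ : 0 < w.γ ∧ w.γ ≤ θ.γ) (hL : w.L = (θ.L : ℝ))
    (hup : ∀ P, w.up P = upOfRecord₅C F N ((θ.pinB8SubBP₂C F N lam).toStage5₁₃CoPH F N) P) :
    IsRecordOfRecord₁₃CSepCoPH F N (datumOfRecord₁₃SepCoPH F N θ h) w :=
  isRecordOfRecord₁₃CSepCoPH_rebindX_of_eq F N θ h hθ _ w hC hγ hL hup

end PinB8SubBP13CoPH

/-! ## §2. The ONE-pin S-bound Stage-13 record with [B8″P] AT THE v1.7 KEY (SepCo); companion in `₁₃CSepCo`; faces; the reading; rebind -/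

section Record13SepCoPHB8subBP

variable (F : T4Family) (N : ℕ) [NeZero N]

/-- **«(D, w) is the record, Stage 13 (separated range), [B8] group pinned over the four-law sub-index ON THE P-CARRIER, `b8` surviving»**: def-T's
`IsRecordOfRecord₁₃CSepCoPH` VERBATIM except that the world is bound by the S-binding over the [B8″P]-PINNED Stage-13 view, for SOME residual [B8] layer `lam`.
[cite: Balaban1985RegularSpaces, Lemma 1 – Thm 8 pp.79–101, Thm 8 (1.146) p.101, (1.12) p.78; Balaban1989LargeFieldII, Thm 1 + (0.1) pp.355–356 (objects of record)] -/
def IsRecordOfRecord₁₃CSepCoPHSB8subBP₂C (D : FiniteEpsData F (SU N)) (w : WorldP) : Prop :=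
  ∃ (θ : Stage13HParams F N) (h : θ.Provisos₁₃SepCoPH F N) (lam : ResidB8 θ.toStage3Params),
    θ.Admissible F N ∧ D = datumOfRecord₁₃SepCoPH F N θ h ∧ w.C = D.C ∧ (0 < w.γ ∧ w.γ ≤ θ.γ) ∧ w.L = (θ.L : ℝ) ∧
      ∀ P : B12.RunParams, w.up P = upOfRecord₅CSC F N ((θ.pinB8SubBP₂C F N lam).toStage5₁₃CoPH F N) (c₇OfRecord θ.toStage3Params) P

/-- Inhabitation is Stage 13's exactly (the residual [B8] type is inhabited, `nonempty_residB8`): every admissible separated-range parameter presents a record of this module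
at its own datum, ANY residual layer `lam`, any window. [cite: Balaban1989LargeFieldII, Thm 1 + (0.1) pp.355–356 (bookkeeping)] -/
theorem exists_world_isRecordOfRecord₁₃CSepCoPHSB8subBP₂C (θ : Stage13HParams F N) (h : θ.Provisos₁₃SepCoPH F N) (hθ : θ.Admissible F N) (lam : ResidB8 θ.toStage3Params)
    {γw : ℝ} (hγw : 0 < γw ∧ γw ≤ θ.γ) :
    ∃ w : WorldP, IsRecordOfRecord₁₃CSepCoPHSB8subBP₂C F N (datumOfRecord₁₃SepCoPH F N θ h) w ∧ w.γ = γw ∧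
      ∀ P : B12.RunParams, w.up P = upOfRecord₅CSC F N ((θ.pinB8SubBP₂C F N lam).toStage5₁₃CoPH F N) (c₇OfRecord θ.toStage3Params) P := by
  obtain ⟨w₀, -, -⟩ := exists_world_isRecordOfRecord₁₃CSepCoPH F N θ h hθ hγw
  exact ⟨{ w₀ with
      C := (datumOfRecord₁₃SepCoPH F N θ h).C, γ := γw, L := (θ.L : ℝ), one_lt_L := by exact_mod_cast θ.hL.2,
      up := fun P => upOfRecord₅CSC F N ((θ.pinB8SubBP₂C F N lam).toStage5₁₃CoPH F N) (c₇OfRecord θ.toStage3Params) P },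
    ⟨θ, h, lam, hθ, rfl, rfl, hγw, rfl, fun _ => rfl⟩, rfl, fun _ => rfl⟩

variable {F N}
variable {D : FiniteEpsData F (SU N)} {w : WorldP}

/-! NOTE (LOCATED-SCLASS-CURRENCY, cell bus 2026-08-28 04:22Z): unlike its parent, a record of this module is NOT a member of dag-n10-d's generic S-class
`Record13SClassSepCoPH.IsRecordOfRecord₁₃CSepCoPHS`, which hard-wires the RS-currency up-binding `upOfRecord₅CS`; the membership lemma of the parent is therefore
NOT imaged here.  An SC-class twin or a `b8`-generic class is the n10-d lineage's ∕ the planners' decision. -/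

/-- **THE SAME-DATUM COMPANION IN `IsRecordOfRecord₁₃CSepCoPH`** (witness `θ.pinB8SubBP₂C lam` under the C-binding): same `D`, `C`, window, `L`; leaves agree off `b8`; companion's
`b8` (typed, over the P-sub-family) ⇒ record's `b8` (surviving) under the carrier law (1.36) ⊂ (1.62) — never conversely.
[cite: Balaban1985RegularSpaces, Thm 8 p.101 (surviving vs typed); Balaban1989LargeFieldII, Thm 1 + (0.1) pp.355–356 (bookkeeping)] -/
theorem companion_of_isRecordOfRecord₁₃CSepCoPHSB8subBP₂C (h : IsRecordOfRecord₁₃CSepCoPHSB8subBP₂C F N D w) :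
    ∃ w' : WorldP, IsRecordOfRecord₁₃CSepCoPH F N D w' ∧ w'.C = w.C ∧ w'.γ = w.γ ∧ w'.L = w.L ∧
      (∀ P : B12.RunParams, leavesP w P = { leavesP w' P with b8 := (leavesP w P).b8 }) ∧
      ∀ P : B12.RunParams, (leavesP w' P).b8 → (leavesP w P).b8 := by
  obtain ⟨θ, hP, lam, hθ, hD, hC, hγ, hL, hup⟩ := h
  have hup' : ∀ P, w.up P = (upOfRecord₅C F N ((θ.pinB8SubBP₂C F N lam).toStage5₁₃CoPH F N) P).withB8 (leavesP w P).b8 := fun P => by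
    show w.up P = (upOfRecord₅C F N _ P).withB8 (w.up P).b8
    rw [hup P]
    rfl
  refine ⟨{ w with up := fun P => upOfRecord₅C F N ((θ.pinB8SubBP₂C F N lam).toStage5₁₃CoPH F N) P },
    ⟨θ.pinB8SubBP₂C F N lam, hP.pinB8SubBP₂C lam, (Stage13HParams.pinB8SubBP₂C_admissible_iff F N _ _).2 hθ, ?_, hC, hγ, hL, fun P => rfl⟩, rfl, rfl, rfl,
      leavesP_eq_of_up_withB8 hup', fun P h8 => ?_⟩
  · rw [datumOfRecord₁₃SepCoPH_pinB8SubBP₂C F N θ hP lam]; exact hD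
  · have h8' := (upOfRecord₅C_toStage5₁₃CoPH_pinB8SubBP₂C_b8_iff F N θ lam P).1 h8
    show (w.up P).b8
    rw [hup P]
    exact (upOfRecord₅CSC_toStage5₁₃CoPH_pinB8SubBP₂C_b8_iff F N θ lam P).2
      (b8LeafOfRecordSubBP₂C_of_b8LeafRS_pinned (le_trans one_le_two (hθ.toStage9.toStage8).1.1.1.1) lam
        (B8LeafKnitRS.b8LeafRS_of_b8LeafR (C136_C162_famB8OfRecordSubBP₂C lam.β lam.len) h8'))

/-- The `b8` leaf at a record of this module, for ONE parameter package: it IS the P-slot. [cite: Balaban1985RegularSpaces, Lemma 1 – Thm 8 pp.79–101 (bookkeeping)] -/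
theorem leaf_b8_iff_of_isRecordOfRecord₁₃CSepCoPHSB8subBP₂C (h : IsRecordOfRecord₁₃CSepCoPHSB8subBP₂C F N D w) :
    ∃ (θ : Stage13HParams F N) (lam : ResidB8 θ.toStage3Params), θ.Admissible F N ∧ w.L = (θ.L : ℝ) ∧
      ∀ P : B12.RunParams, (leavesP w P).b8 ↔ B8LeafOfRecordSubBP₂C θ.toStage3Params lam := by
  obtain ⟨θ, -, lam, hθ, -, -, -, hL, hup⟩ := h
  refine ⟨θ, lam, hθ, hL, fun P => ?_⟩
  show (w.up P).b8 ↔ _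
  rw [hup P]
  exact upOfRecord₅CSC_toStage5₁₃CoPH_pinB8SubBP₂C_b8_iff F N θ lam P

/-- **THE READING AT THE RECORD**: at a record of this module the `b8` leaf is, for its presenting package, «the old pin's FOUR class-free conjuncts (Lemma 1, Prop 5 ∃ ∕ !, Prop 6) ∧ Thm 2 ∕ Prop 3 ∕ Thm 4 on `zdGF3P … ∘ (·.1.1)` ∧
Prop 7 ∕ Thm 8 surviving at γ = 1 AT THE P-MEMBERS» (`CarriersB8SubBP.b8LeafOfRecordSubBP₂C_iff_classFree_and_P₂C`).
[cite: Balaban1985RegularSpaces, Lemma 1 p.79, Thm 2 p.83, Prop. 3 p.87, Thm 4 p.88, Prop. 5 p.94, Prop. 6 p.99, Prop. 7 p.100, Thm 8 (1.146) p.101] -/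
theorem leaf_b8_iff_classFree_and_P₂C_of_isRecordOfRecord₁₃CSepCoPHSB8subBP₂C (h : IsRecordOfRecord₁₃CSepCoPHSB8subBP₂C F N D w) :
    ∃ (θ : Stage13HParams F N) (lam : ResidB8 θ.toStage3Params), θ.Admissible F N ∧ w.L = (θ.L : ℝ) ∧
      ∀ P : B12.RunParams, (leavesP w P).b8 ↔
        (B8.Lemma1Printed θ.D (B8Lemma1NonAbelian.blockPairNA θ.D θ.L θ.𝔸) ∧
          B8.Prop5Exists lam.inp.B₀' lam.B₁ lam.lan ∧ B8.Prop5Unique lam.lan ∧ B8.Prop6Printed θ.D (θ.L : ℝ) lam.B₁ lam.c₁ lam.cub) ∧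
        (B8.Thm2Printed (fun j : IdxB8SubC θ.toStage3Params => (zdGF3P₂ θ.𝔸 θ.L lam.β lam.len j.1.1.1).toGFData) ∧
          B8.Prop3Printed θ.D (θ.L : ℝ) lam.C₂ lam.inp lam.B₀β
            (fun j : IdxB8SubC θ.toStage3Params => (zdGF3P₂ θ.𝔸 θ.L lam.β lam.len j.1.1.1).toGFData2) ∧
          B8.Thm4Printed lam.B₁' (fun j : IdxB8SubC θ.toStage3Params => (zdGF3P₂ θ.𝔸 θ.L lam.β lam.len j.1.1.1).toGFData) ∧
          B8Ineq145.Prop7RepairedC (c₇OfRecord θ.toStage3Params) (fun j : IdxB8SubC θ.toStage3Params => famB8OfRecordSubBP₂C θ.toStage3Params lam.β lam.len j) (fun j => toAxialTowerResid θ.toStage3Params lam.β lam.len j.1.1) ∧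
          B8Thm8Surviving.Thm8SurvivingAt 1 lam.B₁ lam.B₂ (fun j : IdxB8SubC θ.toStage3Params => famB8OfRecordSubBP₂C θ.toStage3Params lam.β lam.len j)) := by
  obtain ⟨θ, lam, hθ, hL, hiff⟩ := leaf_b8_iff_of_isRecordOfRecord₁₃CSepCoPHSB8subBP₂C h
  exact ⟨θ, lam, hθ, hL, fun P => (hiff P).trans (b8LeafOfRecordSubBP₂C_iff_classFree_and_P₂C lam)⟩

/-- A record of this module IS (through its companion) a separated-range Stage-13 record of the same datum at a world with the same `C ∕ γ ∕ L`.
[cite: Balaban1989LargeFieldII, Thm 1 + (0.1) pp.355–356 (bookkeeping)] -/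
theorem exists_isRecordOfRecord₁₃CSepCoPH_of_isRecordOfRecord₁₃CSepCoPHSB8subBP₂C (h : IsRecordOfRecord₁₃CSepCoPHSB8subBP₂C F N D w) :
    ∃ w' : WorldP, IsRecordOfRecord₁₃CSepCoPH F N D w' ∧ w'.C = w.C ∧ w'.γ = w.γ ∧ w'.L = w.L := by
  obtain ⟨w', hw', hC, hγ, hL, -, -⟩ := companion_of_isRecordOfRecord₁₃CSepCoPHSB8subBP₂C h
  exact ⟨w', hw', hC, hγ, hL⟩

/-- … hence (along `IsRecordOfRecord₁₃CSepCoPH.toCoPH`) a Co CORE Stage-13 record of the same datum at a world with the same `C ∕ γ ∕ L` — the projection by which storeys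
keyed ONCE on FILE 21's core family serve this record. [cite: Balaban1989LargeFieldII, Thm 1 + (0.1) pp.355–356 (bookkeeping)] -/
theorem exists_isRecordOfRecord₁₃CCoPH_of_isRecordOfRecord₁₃CSepCoPHSB8subBP₂C (h : IsRecordOfRecord₁₃CSepCoPHSB8subBP₂C F N D w) :
    ∃ w' : WorldP, IsRecordOfRecord₁₃CCoPH F N D w' ∧ w'.C = w.C ∧ w'.γ = w.γ ∧ w'.L = w.L := by
  obtain ⟨w', hw', hC, hγ, hL⟩ := exists_isRecordOfRecord₁₃CSepCoPH_of_isRecordOfRecord₁₃CSepCoPHSB8subBP₂C h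
  exact ⟨w', hw'.toCoPH, hC, hγ, hL⟩

/-- The in-edges `b4 b5 b6 b7` are THEOREMS at a record of this module (via the companion and def-T's v1.7 transfer `atWorld_of_isRecordOfRecord₁₃CSepCoPH`).
[cite: Balaban1983RegularityDecay, Thm p.573; Balaban1984PropagatorsI, Props. 1.1–1.2 pp.33–36; Balaban1984PropagatorsII, pp.223–250; Balaban1985Averaging, Props. 1–10 pp.26–50 (bookkeeping)] -/
theorem b4_b5_b6_b7_of_isRecordOfRecord₁₃CSepCoPHSB8subBP₂C (h : IsRecordOfRecord₁₃CSepCoPHSB8subBP₂C F N D w) (P : B12.RunParams) :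
    (leavesP w P).b4 ∧ (leavesP w P).b5 ∧ (leavesP w P).b6 ∧ (leavesP w P).b7 := by
  obtain ⟨w', hw', -, -, -, hleaves, -⟩ := companion_of_isRecordOfRecord₁₃CSepCoPHSB8subBP₂C h
  have h' : (leavesP w' P).b4 ∧ (leavesP w' P).b5 ∧ (leavesP w' P).b6 ∧ (leavesP w' P).b7 :=
    atWorld_of_isRecordOfRecord₁₃CSepCoPH (X := fun ℓ => ℓ.b4 ∧ ℓ.b5 ∧ ℓ.b6 ∧ ℓ.b7)
      (fun _ _ h5 P =>
        have h4 := b4_main_of_isRecordOfRecord₅C h5 P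
        have hb5 := b5_main_of_isRecordOfRecord₅C h5 P h4
        ⟨h4, hb5, N03_at_record₅C h5 P h4 hb5, b7_main_of_isRecordOfRecord₅C h5 P hb5⟩) hw' P
  rw [hleaves P]
  exact h'

/-- **N05 ∕ N07 ∕ N08 AT A RECORD OF THIS MODULE** (in-edges b4–b7 are theorems). [cite: Balaban1985RegularSpaces, Thm 2 p.83, Thm 8 p.101; Balaban1985Variational, Thm 1 p.279; Balaban1985UV3, Thm 1 p.257 (bookkeeping)] -/
theorem b8_b11_b10_main_iff_of_isRecordOfRecord₁₃CSepCoPHSB8subBP₂C (h : IsRecordOfRecord₁₃CSepCoPHSB8subBP₂C F N D w) (P : B12.RunParams) :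
    (Dag.B8_main (leavesP w P) ↔ ((leavesP w P).b9 → (leavesP w P).b8)) ∧
    (Dag.B11_main (leavesP w P) ↔ ((leavesP w P).b8 → (leavesP w P).b9 → (leavesP w P).b11)) ∧
    (Dag.B10_main (leavesP w P) ↔ ((leavesP w P).b8 → (leavesP w P).b9 → (leavesP w P).b11 → (leavesP w P).b10)) := by
  obtain ⟨-, h5, h6, h7⟩ := b4_b5_b6_b7_of_isRecordOfRecord₁₃CSepCoPHSB8subBP₂C h P
  exact ⟨⟨fun hN h9 => hN h5 h6 h7 h9, fun hN _ _ _ => hN⟩, ⟨fun hN h8 h9 => hN h5 h6 h7 h8 h9, fun hN _ _ _ => hN⟩,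
    ⟨fun hN h8 h9 h11 => hN h5 h6 h7 h8 h9 h11, fun hN _ _ _ => hN⟩⟩

/-- **N05 «SLOT» FORM at a record of this module**: a closer of the P-slot `B8LeafOfRecordSubBP₂C` at every presenting package gives `Dag.B8_main` at every run.
[cite: Balaban1985RegularSpaces, Lemma 1 – Thm 8 pp.79–101, Thm 8 (1.146) p.101 (the node's shape, bookkeeping)] -/
theorem b8_main_of_isRecordOfRecord₁₃CSepCoPHSB8subBP₂C_of_slot (h : IsRecordOfRecord₁₃CSepCoPHSB8subBP₂C F N D w)
    (hB : ∀ (θ : Stage13HParams F N) (hP : θ.Provisos₁₃SepCoPH F N) (lam : ResidB8 θ.toStage3Params), θ.Admissible F N → D = datumOfRecord₁₃SepCoPH F N θ hP →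
      (∀ P, w.up P = upOfRecord₅CSC F N ((θ.pinB8SubBP₂C F N lam).toStage5₁₃CoPH F N) (c₇OfRecord θ.toStage3Params) P) → B8LeafOfRecordSubBP₂C θ.toStage3Params lam)
    (P : B12.RunParams) : Dag.B8_main (leavesP w P) := by
  obtain ⟨h8iff, -, -⟩ := b8_b11_b10_main_iff_of_isRecordOfRecord₁₃CSepCoPHSB8subBP₂C h P
  obtain ⟨θ, hP, lam, hθ, hD, -, -, -, hup⟩ := h
  refine h8iff.2 fun _ => ?_
  show (w.up P).b8
  rw [hup P]
  exact (upOfRecord₅CSC_toStage5₁₃CoPH_pinB8SubBP₂C_b8_iff F N θ lam P).2 (hB θ hP lam hθ hD hup)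

/-- ★ **N05 «SLOT» FORM, READ — EIGHT CONJUNCTS, `p7` SUPPLIED**: a supplier of the four class-free conjuncts and of Thm 2 ∕ Prop 3 ∕ Thm 4 ∕ Thm 8 AT THE δ₂-MEMBERS over the
admissible sub-index, at every presenting package, gives `Dag.B8_main` at every run of a record of this module — Proposition 7 (repaired currency, print's map) is supplied
inside by `CarriersB8SubBP2C.b8LeafOfRecordSubBP₂C_of_fields` (`2 ≤ θ.D` from admissibility: `(hθ.toStage9.toStage8).1.1.1.1`). [cite: Balaban1985RegularSpaces, Lemma 1 – Thm 8 pp.79–101, Prop. 7 (1.145) p.100, Thm 8 (1.146) p.101] -/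
theorem b8_main_of_isRecordOfRecord₁₃CSepCoPHSB8subBP₂C_of_fields (h : IsRecordOfRecord₁₃CSepCoPHSB8subBP₂C F N D w)
    (hB : ∀ (θ : Stage13HParams F N) (hP : θ.Provisos₁₃SepCoPH F N) (lam : ResidB8 θ.toStage3Params), θ.Admissible F N → D = datumOfRecord₁₃SepCoPH F N θ hP →
      (∀ P, w.up P = upOfRecord₅CSC F N ((θ.pinB8SubBP₂C F N lam).toStage5₁₃CoPH F N) (c₇OfRecord θ.toStage3Params) P) →
        B8.Lemma1Printed θ.D (B8Lemma1NonAbelian.blockPairNA θ.D θ.L θ.𝔸) ∧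
        B8.Thm2Printed (fun j : IdxB8SubC θ.toStage3Params => (zdGF3P₂ θ.𝔸 θ.L lam.β lam.len j.1.1.1).toGFData) ∧
        B8.Prop3Printed θ.D (θ.L : ℝ) lam.C₂ lam.inp lam.B₀β
            (fun j : IdxB8SubC θ.toStage3Params => (zdGF3P₂ θ.𝔸 θ.L lam.β lam.len j.1.1.1).toGFData2) ∧
        B8.Thm4Printed lam.B₁' (fun j : IdxB8SubC θ.toStage3Params => (zdGF3P₂ θ.𝔸 θ.L lam.β lam.len j.1.1.1).toGFData) ∧
        B8.Prop5Exists lam.inp.B₀' lam.B₁ lam.lan ∧ B8.Prop5Unique lam.lan ∧ B8.Prop6Printed θ.D (θ.L : ℝ) lam.B₁ lam.c₁ lam.cub ∧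
        B8Thm8Surviving.Thm8SurvivingAt 1 lam.B₁ lam.B₂ (fun j : IdxB8SubC θ.toStage3Params => famB8OfRecordSubBP₂C θ.toStage3Params lam.β lam.len j))
    (P : B12.RunParams) : Dag.B8_main (leavesP w P) :=
  b8_main_of_isRecordOfRecord₁₃CSepCoPHSB8subBP₂C_of_slot h (fun θ hP lam hθ hD hup =>
    have H := hB θ hP lam hθ hD hup
    b8LeafOfRecordSubBP₂C_of_fields (hθ.toStage9.toStage8).1.1.1.1 lam H.1 H.2.1 H.2.2.1 H.2.2.2.1 H.2.2.2.2.1 H.2.2.2.2.2.1 H.2.2.2.2.2.2.1 H.2.2.2.2.2.2.2) P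

/-- RE-BINDING a `₁₃CSep` record's world by the S-binding over the [B8″P]-pinned view gives a record of this module with the SAME datum — the ∃-currency entry point (the [B8]
layer `lam`, e.g. the cut layer `λ.cutSubB J lan c₁`, is CHOSEN here). [cite: Balaban1989LargeFieldII, Thm 1 p.355 (bookkeeping)] -/
theorem isRecordOfRecord₁₃CSepCoPHSB8subBP₂C_rebind_of_isRecordOfRecord₁₃CSepCoPH (h : IsRecordOfRecord₁₃CSepCoPH F N D w) :
    ∃ (θ : Stage13HParams F N) (_ : θ.Provisos₁₃SepCoPH F N), θ.Admissible F N ∧ (∀ P, w.up P = upOfRecord₅C F N (θ.toStage5₁₃CoPH F N) P) ∧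
      ∀ lam : ResidB8 θ.toStage3Params,
        IsRecordOfRecord₁₃CSepCoPHSB8subBP₂C F N D { w with up := fun P => upOfRecord₅CSC F N ((θ.pinB8SubBP₂C F N lam).toStage5₁₃CoPH F N) (c₇OfRecord θ.toStage3Params) P } := by
  obtain ⟨θ, hP, hθ, hD, hC, hγ, hL, hup⟩ := h
  exact ⟨θ, hP, hθ, hup, fun lam => ⟨θ, hP, lam, hθ, hD, hC, hγ, hL, fun _ => rfl⟩⟩

/-- Every record of this module sits at a v1.7 datum of record presented by admissible separated-range parameters (projection). [cite: Balaban1989LargeFieldII, Thm 1 + (0.1) pp.355–356 (bookkeeping)] -/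
theorem exists_provisos_of_isRecordOfRecord₁₃CSepCoPHSB8subBP₂C (h : IsRecordOfRecord₁₃CSepCoPHSB8subBP₂C F N D w) :
    ∃ (θ : Stage13HParams F N) (hP : θ.Provisos₁₃SepCoPH F N), θ.Admissible F N ∧ D = datumOfRecord₁₃SepCoPH F N θ hP := by
  obtain ⟨θ, hP, -, hθ, hD, -⟩ := h
  exact ⟨θ, hP, hθ, hD⟩

end Record13SepCoPHB8subBP


end Literature.MathematicalPhysics.QuantumFieldTheory.Balaban1983to89.Node00

end
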